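import Summits.QuantumAdvantage.QuantumAdvantage.Theses.LinnikCubicClassGroups
import Mathlib.Analysis.SpecialFunctions.Log.Basic
import Mathlib.Analysis.Complex.ExponentialBounds
import Mathlib.Data.Nat.Size

/-!
# Crux `LinnikCubicClassGroups.PureCubicClassGroupFBQP` (stmt-QuantumAdvantage-11544) — stub `stub_classTableSem`, part NUMERICS II

Line `arakelov-giant-step-cycle`, stub `stub_classTableSem` (S5b-P5b): the remaining real-variable inequalities of the structural
interface — all walk errors, the exponent-weighted rounding budget of `b_E` and the `R̂`-versus-`R` drift fit in one eighth of a grid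
cell `R/2^s` thanks to the advice precision `k ≥ ℓe + s + npp + 60 + 6 LD + e + 2 size|ps|` and `prec ≥ k + s + npp + 64`
(`num_eta`, `num_etaerr`, `num_BN`), and the defect count per exponent block is `≤ 2^-(30+e) 2^ℓy` (`num_defect_card`).
-/

set_option linter.dupNamespace false

namespace Summit.QuantumAdvantage.QuantumAdvantage.Theorems.LinnikCubicClassGroups

/-- `KN = 10 size(ab) + 48 ≤ 2^(LD + 6)` when `size(ab) ≤ LD`. -/
theorem num_KN_le {sab LD : ℕ} (h : sab ≤ LD) : ((10 * sab + 48 : ℕ) : ℝ) ≤ 2 ^ (LD + 6) := by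
  have h1 : (LD : ℝ) ≤ 2 ^ LD := by exact_mod_cast (Nat.lt_two_pow_self).le
  have h2 : (1 : ℝ) ≤ 2 ^ LD := one_le_pow₀ (by norm_num)
  have h3 : (sab : ℝ) ≤ LD := by exact_mod_cast h
  rw [pow_add]; push_cast; nlinarith

/-- **The position-error budget fits**: `(3 T 2^ℓe + 3 (L+1) 2^L (s₀+1) + 20 KN² + 2)/2^prec ≤ R/2^(s+3)`
(`L = 6 LD + 9`, `s₀ = 18 KN`, `T = 3|ps|`). -/
theorem num_eta {ℓe s npp LD e sz k prec np sab : ℕ} {R : ℝ} (hR : (1 : ℝ) / 16 ≤ R) (hsz : np < 2 ^ sz) (hsab : sab ≤ LD)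
    (hk : ℓe + s + npp + 60 + 6 * LD + e + 2 * sz ≤ k) (hprec : k + s + npp + 64 ≤ prec) (hs : npp + 6 * LD + 50 + e ≤ s) :
    (3 * ((3 * np : ℕ) : ℝ) * 2 ^ ℓe + 3 * (((6 * LD + 9 : ℕ) : ℝ) + 1) * (2 ^ (6 * LD + 9) * (((18 * (10 * sab + 48) : ℕ) : ℝ) + 1)) +
        20 * ((10 * sab + 48 : ℕ) : ℝ) ^ 2 + 2) / 2 ^ prec ≤ R / 2 ^ (s + 3) := by
  have hKN := num_KN_le hsab
  have hnp : (np : ℝ) ≤ 2 ^ sz := by exact_mod_cast hsz.le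
  have hLDp : (LD : ℝ) ≤ 2 ^ LD := by exact_mod_cast (Nat.lt_two_pow_self).le
  have h1LD : (1 : ℝ) ≤ 2 ^ LD := one_le_pow₀ (by norm_num)
  -- bound each term by a power of two with exponent `M = sz + ℓe + 8 LD + 26`
  set M : ℕ := sz + ℓe + 8 * LD + 26 with hM
  have hA : 3 * ((3 * np : ℕ) : ℝ) * 2 ^ ℓe ≤ 2 ^ M := by
    have : (2 : ℝ) ^ (sz + ℓe + 4) ≤ 2 ^ M := pow_le_pow_right₀ (by norm_num) (by omega)
    have e1 : (2 : ℝ) ^ (sz + ℓe + 4) = 2 ^ sz * 2 ^ ℓe * 16 := by rw [pow_add, pow_add]; norm_num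
    push_cast; nlinarith [show (0 : ℝ) ≤ 2 ^ ℓe by positivity, mul_le_mul_of_nonneg_right hnp (by positivity : (0 : ℝ) ≤ 2 ^ ℓe)]
  have hB : 3 * (((6 * LD + 9 : ℕ) : ℝ) + 1) * (2 ^ (6 * LD + 9) * (((18 * (10 * sab + 48) : ℕ) : ℝ) + 1)) ≤ 2 ^ M := by
    have hL : ((6 * LD + 9 : ℕ) : ℝ) + 1 ≤ 16 * 2 ^ LD := by push_cast; nlinarith
    have hS : ((18 * (10 * sab + 48) : ℕ) : ℝ) + 1 ≤ 2 ^ (LD + 11) := by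
      rw [pow_add]; push_cast; push_cast at hKN; rw [pow_add] at hKN; nlinarith
    have : (2 : ℝ) ^ (8 * LD + 26) ≤ 2 ^ M := pow_le_pow_right₀ (by norm_num) (by omega)
    have e1 : (2 : ℝ) ^ (8 * LD + 26) = 64 * (2 ^ LD * (2 ^ (6 * LD + 9) * 2 ^ (LD + 11))) := by
      rw [show 8 * LD + 26 = 6 + (LD + ((6 * LD + 9) + (LD + 11))) by omega, pow_add, pow_add, pow_add]; norm_num
    calc 3 * (((6 * LD + 9 : ℕ) : ℝ) + 1) * (2 ^ (6 * LD + 9) * (((18 * (10 * sab + 48) : ℕ) : ℝ) + 1))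
        ≤ 3 * (16 * 2 ^ LD) * (2 ^ (6 * LD + 9) * 2 ^ (LD + 11)) := by gcongr
      _ ≤ 2 ^ (8 * LD + 26) := by rw [e1]; nlinarith [show (0:ℝ) ≤ 2 ^ LD * (2 ^ (6 * LD + 9) * 2 ^ (LD + 11)) by positivity]
      _ ≤ 2 ^ M := this
  have hC : 20 * ((10 * sab + 48 : ℕ) : ℝ) ^ 2 + 2 ≤ 2 ^ M := by
    have : (2 : ℝ) ^ (2 * LD + 17) ≤ 2 ^ M := pow_le_pow_right₀ (by norm_num) (by omega)
    have e1 : (2 : ℝ) ^ (2 * LD + 17) = (2 ^ (LD + 6)) ^ 2 * 32 := by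
      rw [← pow_mul, show (32 : ℝ) = 2 ^ 5 by norm_num, ← pow_add]; congr 1; omega
    have h0 : (0 : ℝ) ≤ ((10 * sab + 48 : ℕ) : ℝ) := by positivity
    have hsq : ((10 * sab + 48 : ℕ) : ℝ) ^ 2 ≤ (2 ^ (LD + 6)) ^ 2 := pow_le_pow_left₀ h0 hKN 2
    have h64 : (64 : ℝ) ^ 2 ≤ (2 ^ (LD + 6)) ^ 2 := by
      apply pow_le_pow_left₀ (by norm_num); rw [pow_add]; nlinarith
    nlinarith
  have hsum : 3 * ((3 * np : ℕ) : ℝ) * 2 ^ ℓe + 3 * (((6 * LD + 9 : ℕ) : ℝ) + 1) * (2 ^ (6 * LD + 9) * (((18 * (10 * sab + 48) : ℕ) : ℝ) + 1)) +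
      20 * ((10 * sab + 48 : ℕ) : ℝ) ^ 2 + 2 ≤ 2 ^ (M + 2) := by
    have : (2 : ℝ) ^ (M + 2) = 2 ^ M * 4 := by rw [pow_add]; norm_num
    have hM0 : (0 : ℝ) ≤ 2 ^ M := by positivity
    linarith
  -- compare exponents
  have hexp : M + 2 + (s + 3) + 4 ≤ prec := by omega
  have hpw : (2 : ℝ) ^ (M + 2) * 2 ^ (s + 3) * 16 ≤ 2 ^ prec := by
    rw [show (16 : ℝ) = 2 ^ 4 by norm_num, ← pow_add, ← pow_add]; exact pow_le_pow_right₀ (by norm_num) hexp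
  rw [div_le_div_iff₀ (by positivity) (by positivity)]
  calc (3 * ((3 * np : ℕ) : ℝ) * 2 ^ ℓe + 3 * (((6 * LD + 9 : ℕ) : ℝ) + 1) * (2 ^ (6 * LD + 9) * (((18 * (10 * sab + 48) : ℕ) : ℝ) + 1)) +
        20 * ((10 * sab + 48 : ℕ) : ℝ) ^ 2 + 2) * 2 ^ (s + 3)
      ≤ 2 ^ (M + 2) * 2 ^ (s + 3) := mul_le_mul_of_nonneg_right hsum (by positivity)
    _ ≤ 2 ^ prec * (1 / 16) := by rw [mul_one_div, le_div_iff₀ (by norm_num)]; exact hpw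
    _ ≤ 2 ^ prec * R := mul_le_mul_of_nonneg_left hR (by positivity)
    _ = R * 2 ^ prec := mul_comm _ _

/-- **The wrap-count budget**: `BN = 2 + (3S + 2^prec 2 LB S)/Rint ≤ 2 + 48 T 2^ℓe LB`. -/
theorem num_BN {prec : ℕ} {S Tm LB Rint : ℝ} (hS0 : 0 ≤ S) (hS : S ≤ Tm) (hLB : 3 / 2 ^ prec ≤ LB)
    (hRint : 2 ^ prec / 16 ≤ Rint) :
    2 + (3 * S + 2 ^ prec * (2 * LB) * S) / Rint ≤ 2 + 48 * Tm * LB := by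
  have h2p : (0 : ℝ) < 2 ^ prec := by positivity
  have hR0 : 0 < Rint := lt_of_lt_of_le (by positivity) hRint
  have hLB0 : 0 ≤ LB := le_trans (by positivity) hLB
  have h3 : 3 * S ≤ 2 ^ prec * LB * S := by
    have := mul_le_mul_of_nonneg_right hLB hS0
    rw [div_mul_eq_mul_div, div_le_iff₀ h2p] at this
    nlinarith
  have hnum : 3 * S + 2 ^ prec * (2 * LB) * S ≤ 2 ^ prec * (3 * LB * Tm) := by nlinarith [mul_le_mul_of_nonneg_left hS hLB0]
  have : (3 * S + 2 ^ prec * (2 * LB) * S) / Rint ≤ 48 * Tm * LB := by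
    rw [div_le_iff₀ hR0]
    calc 3 * S + 2 ^ prec * (2 * LB) * S ≤ 2 ^ prec * (3 * LB * Tm) := hnum
      _ = (48 * Tm * LB) * (2 ^ prec / 16) := by ring
      _ ≤ (48 * Tm * LB) * Rint := mul_le_mul_of_nonneg_left hRint (mul_nonneg (mul_nonneg (by norm_num) (hS0.trans hS)) hLB0)
  linarith

/-- **The drift budget fits**: `2^-k (1 + (2 + 48 T 2^ℓe LB)) ≤ R/2^(s+3)` (`LB ≤ 2^(LD+6)`, `T = 3|ps|`). -/
theorem num_etaerr {ℓe s npp LD e sz k np : ℕ} {R LB : ℝ} (hR : (1 : ℝ) / 16 ≤ R) (hsz : np < 2 ^ sz)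
    (hLB0 : 0 ≤ LB) (hLB : LB ≤ 2 ^ (LD + 6)) (hk : ℓe + s + npp + 60 + 6 * LD + e + 2 * sz ≤ k) :
    1 / 2 ^ k * (1 + (2 + 48 * (((3 * np : ℕ) : ℝ) * 2 ^ ℓe) * LB)) ≤ R / 2 ^ (s + 3) := by
  have hnp : (np : ℝ) ≤ 2 ^ sz := by exact_mod_cast hsz.le
  set M : ℕ := sz + ℓe + LD + 16 with hM
  have hsum : 1 + (2 + 48 * (((3 * np : ℕ) : ℝ) * 2 ^ ℓe) * LB) ≤ 2 ^ M := by
    have e1 : (2 : ℝ) ^ M = 2 ^ sz * 2 ^ ℓe * 2 ^ (LD + 6) * 1024 := by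
      rw [hM, show sz + ℓe + LD + 16 = sz + ℓe + (LD + 6) + 10 by omega, pow_add, pow_add, pow_add]; norm_num
    rw [e1]; push_cast
    have h1 : (1 : ℝ) ≤ 2 ^ sz * 2 ^ ℓe * 2 ^ (LD + 6) := by
      have a1 : (1:ℝ) ≤ 2 ^ sz := one_le_pow₀ (by norm_num)
      have a2 : (1:ℝ) ≤ 2 ^ ℓe := one_le_pow₀ (by norm_num)
      have a3 : (1:ℝ) ≤ 2 ^ (LD + 6) := one_le_pow₀ (by norm_num)
      calc (1:ℝ) = 1 * 1 * 1 := by ring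
        _ ≤ 2 ^ sz * 2 ^ ℓe * 2 ^ (LD + 6) := by gcongr
    have h2 : (np : ℝ) * 2 ^ ℓe * LB ≤ 2 ^ sz * 2 ^ ℓe * 2 ^ (LD + 6) := by gcongr
    nlinarith [mul_nonneg (mul_nonneg (by positivity : (0:ℝ) ≤ np) (by positivity : (0:ℝ) ≤ 2 ^ ℓe)) hLB0]
  have hexp : M + (s + 3) + 4 ≤ k := by omega
  have hpw : (2 : ℝ) ^ M * 2 ^ (s + 3) * 16 ≤ 2 ^ k := by
    rw [show (16 : ℝ) = 2 ^ 4 by norm_num, ← pow_add, ← pow_add]; exact pow_le_pow_right₀ (by norm_num) hexp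
  rw [one_div, inv_mul_eq_div, div_le_div_iff₀ (by positivity) (by positivity)]
  calc (1 + (2 + 48 * (((3 * np : ℕ) : ℝ) * 2 ^ ℓe) * LB)) * 2 ^ (s + 3) ≤ 2 ^ M * 2 ^ (s + 3) :=
        mul_le_mul_of_nonneg_right hsum (by positivity)
    _ ≤ 2 ^ k * (1 / 16) := by rw [mul_one_div, le_div_iff₀ (by norm_num)]; exact hpw
    _ ≤ 2 ^ k * R := mul_le_mul_of_nonneg_left hR (by positivity)
    _ = R * 2 ^ k := mul_comm _ _

/-- **The defect count per exponent block**: `2 (2^npp (q R + LB) + q n₀ + 1) ≤ 2^-(30+e) 2^ℓy` for `q = 2^(ℓy−s) + 1`,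
`R, LB ≤ d⁶`, `n₀ ≤ 9 d⁶`, `d < 2^LD`, `s ≥ npp + 6 LD + 36 + e`, `s ≤ ℓy`. -/
theorem num_defect_card {npp s ℓy LD e n₀ : ℕ} {R LB d : ℝ} (hR0 : 0 ≤ R) (hRd : R ≤ d ^ 6) (hLB : LB ≤ d ^ 6)
    (hn₀ : (n₀ : ℝ) ≤ 9 * d ^ 6) (hd1 : 1 ≤ d) (hd : d < 2 ^ LD) (hs : npp + 6 * LD + 36 + e ≤ s) (hsy : s ≤ ℓy) :
    2 * (2 ^ npp * (((2 ^ (ℓy - s) + 1 : ℕ) : ℝ) * R + LB) + ((2 ^ (ℓy - s) + 1 : ℕ) : ℝ) * n₀ + 1) ≤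
      (1 / 2) ^ (30 + e) * 2 ^ ℓy := by
  have hd6 : d ^ 6 < (2 : ℝ) ^ (6 * LD) := by
    calc d ^ 6 < ((2 : ℝ) ^ LD) ^ 6 := pow_lt_pow_left₀ hd (by linarith) (by norm_num)
      _ = 2 ^ (6 * LD) := by rw [← pow_mul, mul_comm]
  have hd61 : (1 : ℝ) ≤ d ^ 6 := one_le_pow₀ hd1
  have hq : ((2 ^ (ℓy - s) + 1 : ℕ) : ℝ) ≤ 2 ^ (ℓy - s + 1) := by
    have h : 2 ^ (ℓy - s) + 1 ≤ 2 ^ (ℓy - s + 1) := by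
      rw [pow_succ]; have := Nat.one_le_two_pow (n := ℓy - s); omega
    exact_mod_cast h
  have hq0 : (0 : ℝ) ≤ ((2 ^ (ℓy - s) + 1 : ℕ) : ℝ) := by positivity
  -- `LHS ≤ 2^(ℓy - s + 1) d⁶ 2^(npp + 5)`
  have h1 : 2 * (2 ^ npp * (((2 ^ (ℓy - s) + 1 : ℕ) : ℝ) * R + LB) + ((2 ^ (ℓy - s) + 1 : ℕ) : ℝ) * n₀ + 1) ≤
      2 ^ (ℓy - s + 1) * d ^ 6 * 2 ^ (npp + 5) := by
    set q : ℝ := ((2 ^ (ℓy - s) + 1 : ℕ) : ℝ) with hqdef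
    have hq1 : 1 ≤ q := by rw [hqdef]; exact_mod_cast Nat.le_add_left 1 (2 ^ (ℓy - s))
    have h2n : (1 : ℝ) ≤ 2 ^ npp := one_le_pow₀ (by norm_num)
    have e5 : (2 : ℝ) ^ (npp + 5) = 2 ^ npp * 32 := by rw [pow_add]; norm_num
    rw [e5]
    have a1 : q * R + LB ≤ 2 * q * d ^ 6 := by nlinarith
    have a2 : q * (n₀ : ℝ) ≤ 9 * q * d ^ 6 := by nlinarith
    have a3 : (1 : ℝ) ≤ q * d ^ 6 := by nlinarith
    calc 2 * (2 ^ npp * (q * R + LB) + q * n₀ + 1) ≤ 2 * (2 ^ npp * (2 * q * d ^ 6) + 9 * q * d ^ 6 + q * d ^ 6) := by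
          gcongr
      _ = q * d ^ 6 * (4 * 2 ^ npp + 20) := by ring
      _ ≤ q * d ^ 6 * (2 ^ npp * 32) := by
          apply mul_le_mul_of_nonneg_left _ (by positivity); nlinarith
      _ ≤ 2 ^ (ℓy - s + 1) * d ^ 6 * (2 ^ npp * 32) := by gcongr
  refine h1.trans ?_
  -- `2^(ℓy - s + 1) d⁶ 2^(npp+5) ≤ 2^(ℓy - s + 1 + 6 LD + npp + 5) ≤ 2^-(30+e) 2^ℓy`
  have h2 : (2 : ℝ) ^ (ℓy - s + 1) * d ^ 6 * 2 ^ (npp + 5) ≤ 2 ^ (ℓy - s + 1 + 6 * LD + (npp + 5)) := by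
    rw [pow_add _ (ℓy - s + 1 + 6 * LD), pow_add _ (ℓy - s + 1)]
    gcongr
  refine h2.trans ?_
  have hexp : ℓy - s + 1 + 6 * LD + (npp + 5) + (30 + e) ≤ ℓy := by omega
  have : (2 : ℝ) ^ (ℓy - s + 1 + 6 * LD + (npp + 5)) * 2 ^ (30 + e) ≤ 2 ^ ℓy := by
    rw [← pow_add]; exact pow_le_pow_right₀ (by norm_num) hexp
  rw [one_div, inv_pow, ← div_eq_inv_mul, le_div_iff₀ (by positivity)]
  exact this


/-- **P5b helper `classTableSem_num_defect_card`** (registered): the defect count per exponent block fits the density. -/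
theorem classTableSem_num_defect_card : ∀ (npp s ℓy LD e n₀ : ℕ) (R LB d : ℝ), 0 ≤ R → R ≤ d ^ 6 → LB ≤ d ^ 6 → (n₀ : ℝ) ≤ 9 * d ^ 6 → 1 ≤ d → d < 2 ^ LD → npp + 6 * LD + 36 + e ≤ s → s ≤ ℓy → 2 * (2 ^ npp * (((2 ^ (ℓy - s) + 1 : ℕ) : ℝ) * R + LB) + ((2 ^ (ℓy - s) + 1 : ℕ) : ℝ) * n₀ + 1) ≤ (1 / 2) ^ (30 + e) * 2 ^ ℓy :=
  fun _ _ _ _ _ _ _ _ _ hR0 hRd hLB hn₀ hd1 hd hs hsy => num_defect_card hR0 hRd hLB hn₀ hd1 hd hs hsy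

end Summit.QuantumAdvantage.QuantumAdvantage.Theorems.LinnikCubicClassGroups
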